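import Summits.QuantumFields.YangMills.Theorems.FluctuationComparisonRegPrIntLS2BetaRelativeFieldLetterTwoTowerLocal
import Summits.QuantumFields.YangMills.Theorems.FluctuationComparisonRegPrIntLS2BetaOneStepLocalAxialBounds
import HarnessLib

/-!
# S2β · letter (D♮) REL-TEL, feeder F2-rel (UV3-NODE §84.4 (H♭)(i)), FILE C3:
# THE TWO-TOWER BOND LETTERS WITH EVERY INPUT A NEIGHBOURHOOD SUM — interior and face bonds, any gauge group

Cell `ym3-torus` (YM ladder rung R3 = continuum `SU(2)` Yang–Mills on the three-torus — a RUNG: NOT d = 4, NOT infinite volume, NOT a mass gap, NOT Clay).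
Width seat «width 21» `ym3-torus-px21` (gen 23), FREE px helper on crux `stmt-QuantumFields-20520`; `--kind proof --supports stmt-QuantumFields-20520 --as helper`,
count-neutral, DEFINITION-FREE (0 `def`, 0 `instance`, 0 `notation`, 0 `sorry`, default heartbeats), any gauge group + px10's commutator letter `hcomm`.

WHAT.  FILE C1 ✓`…RelativeFieldLetterTwoTower` gave the two-tower flap letters with abstract inputs `a, b, s, θ₁, θ₂, σ, t`; FILE C2 ✓`…TwoTowerLocal` located the count
boxes of the loop words (one block ∕ three blocks).  Here every abstract input is DISCHARGED by a landed lemma with LOCAL data near `y = blockOf b₋`: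
`a` ∕ `b` by ✓p823652 `dist1_holAt_rel_le_local` (relative crude Stokes for closed words), `θ₁` ∕ `θ₂` by lit ✓`LatticeWordStokes.dist1_holAt_le`, `t` by ✓p823337
`dist1_holAt_walk_rel_le_local`; `s` (relative spine quotient) and `σ` (its size) stay as letters for FILE C4 (`SU(N)`: F4-rel ✓`…CorrLetterL2Relative`, G12).  With the
neighbourhoods `N(y)` (fine plaquettes based in blocks near `y`) and `N_b(y)` (fine bonds based in blocks near `y`) of F4 ∕ F4-rel and `K′ = (d+2)L`, `K = K′²∕4`:
* §1 `length_contourT_le`, `length_faceLoop_le` (`≤ K′`; px12's ✓`l1_rel_emb_le` ∕ ✓`netDisp_faceLoop`, px10's ✓`netDisp_contourT`), the monotone bound.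
* §2 ★★`dist1_flap_rel_le_interior_nbhd` — `δ(W_b·U_b⁻¹, W⁰_b·U⁰_b⁻¹) ≤ K·(Σ_N δ(W,W⁰) + 2θ_W(K′+2)·Σ_{N_b} dev(W,W⁰)) + K·(Σ_N δ(U,U⁰) + 2θ_U(K′+2)·Σ_{N_b} dev(U,U⁰))
  + 2·(Kθ_W + Kθ_U)·(K′·Σ_{N_b} dev(U,U⁰))` under `PlaqSmall θ_W W`, `PlaqSmall θ_U U` (tower 1 carries every SIZE: take tower 1 := the BACKGROUND (argmin) tower and
  tower 0 := the history tower, per px12 g24's 13:07:55Z count «SIZE := BKG-tower»; `δ` is symmetric).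
* §3 ★★`dist1_flap_rel_le_face_nbhd` — the same at a FACE bond plus the relative spine quotient `dist1 (S⁰⁻¹·S)` VERBATIM and `+ 2σ·(K′·Σ_{N_b} dev(U,U⁰))`, `σ ≥ dist1 S`,
  `S = T_c(W)·T_c(U)⁻¹` at `c = ⟨y, μ⟩`.
Every right-hand term vanishes when the two towers coincide.

HONEST SCOPE.  Instantiation of landed lemmas + word-length arithmetic; nothing of Bałaban's is asserted; F2-rel in `ℓ²` (FILE C4), (H♭)∕(H♭♭), the BKG-tower size letter,
(D-ax)∕(D♮), (F♮), GAP♯∘ (`stub_uniformFibreGapOrbit`), S2β, the five registered stubs (0∕5), crux 20520, 19936, 19200 and `YM3TorusSU2` are NOT proved; no registered stub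
is closed; rung R3 = SU(2) YM₃ on T³ — NOT d = 4, NOT infinite volume, NOT a mass gap, NOT Clay; the Yang–Mills mass gap is NOT proved.
References: T. Bałaban, CMP **99** (1985) 75–102 [Balaban1985RegularSpaces] (Lemma 1 (1.24)–(1.26) pp.79–80); CMP **98** (1985) 17–51 [Balaban1985Averaging]
((19)–(20) p.21, pp.24–25); CMP **109** (1987) 249–301 [Balaban1987RG1] ((0.3)–(0.4) pp.252–253).
-/

set_option autoImplicit false

namespace Summit.QuantumFields.YangMills.Theorems.FluctuationComparisonRegPrIntLS2BetaRelativeFieldLetterTwoTowerNbhd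

open Finset
open Literature.MathematicalPhysics.QuantumFieldTheory.Balaban1983to89
open T4Continuum T4ReflectionCone BlockAveraging
open B10Eq47AxialChi (shiftN rowProd)
open B10Eq27TorusAxialLog (rel transl holT axialT contourT holT_eq_holAt contourT_eq rel_shift_of_le)
open B7Prop1Explicit (treeWord seg e e_apply l1 length_treeWord)
open T4TiltOscillation (bdev)
open T4ExpWindowSmallField (dist1_bdev_comm)
open Summit.QuantumFields.YangMills.Theorems.Prop7AxialGaugeSup (revWord_eq_wordRev)
open Summit.QuantumFields.YangMills.Theorems.FluctuationComparisonRegPrIntLS2BetaIterAxialGaugeOneLevel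
  (noWrap_emb natAbs_rel_emb_le rel_emb_face rel_emb_shift_of_face l1_rel_emb_le netDisp_faceLoop)
open Summit.QuantumFields.YangMills.Theorems.FluctuationComparisonRegPrIntLS2BetaCorrLetterL2 (near_self)
open Summit.QuantumFields.YangMills.Theorems.FluctuationComparisonRegPrIntLS2BetaRelativeSwapDefect (dist1_holAt_walk_rel_le_local)
open Summit.QuantumFields.YangMills.Theorems.FluctuationComparisonRegPrIntLS2BetaRelativeWordStokes (dist1_holAt_rel_le_local)
open Summit.QuantumFields.YangMills.Theorems.FluctuationComparisonRegPrIntLS2BetaRelativeFieldLetterTwoTower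
  (dist1_flap_rel_le_interior dist1_flap_rel_le_face)
open Summit.QuantumFields.YangMills.Theorems.FluctuationComparisonRegPrIntLS2BetaRelativeFieldLetterTwoTowerLocal
  (blockOf_walkEnd_of_count_le_contour near_walkEnd_of_count_le_faceLoop)
open Summit.QuantumFields.YangMills.Theorems.FluctuationComparisonRegPrIntLS2BetaOneStepLocalAxialBounds (netDisp_contourT)

variable {P : Params} {j : ℕ}

/-! ## §1 Word lengths, closedness, the monotone bound -/

/-- **The contour word of an interior bond has length `≤ (d+2)L`.** [cite: Balaban1985UV3, (27) p.263] -/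
theorem length_contourT_le (hj : j + 1 ≤ P.m + P.K) {x : Site P j} {y : Site P (j + 1)} (hx : blockOf x = y) (μ : Fin P.d)
    (hblock : blockOf (x.shift μ) = y) : (contourT (emb y) ⟨x, μ⟩).length ≤ (P.d + 2) * P.L := by
  have hL := AveragingRT.two_mul_half_add_one P
  have h1 := l1_rel_emb_le hj hx
  have h2 := l1_rel_emb_le hj hblock
  rw [rel_shift_of_le _ _ _ (noWrap_emb hj hx μ)] at h2
  rw [contourT_eq, revWord_eq_wordRev, List.length_append, List.length_append, length_treeWord, List.length_singleton, wordRev,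
    List.length_reverse, List.length_map, length_treeWord]
  have h4 : 2 * (P.d * ((P.L - 1) / 2)) + P.d = P.d * P.L := by
    conv_rhs => rw [← hL]
    ring
  have h5 : (P.d + 2) * P.L = P.d * P.L + 2 * P.L := by ring
  simp only [] at h1 h2 ⊢
  omega

/-- **The closed face word has length `≤ (d+2)L`.** [cite: Balaban1987RG1, (0.3) p.252] -/
theorem length_faceLoop_le (hj : j + 1 ≤ P.m + P.K) {x : Site P j} {y : Site P (j + 1)} (hx : blockOf x = y) {μ : Fin P.d}
    (hface : (x μ).val % P.L + 1 = P.L) :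
    ((treeWord (rel (emb y) x) ++ [(μ, true)] ++ wordRev (treeWord (rel (emb (y.shift μ)) (x.shift μ)))) ++ List.replicate P.L (μ, false)).length ≤
      (P.d + 2) * P.L := by
  have hL := AveragingRT.two_mul_half_add_one P
  have hblock : blockOf (x.shift μ) = y.shift μ := by rw [B10StarCount.blockOf_shift hj, if_pos hface, hx]
  have h1 := l1_rel_emb_le hj hx
  have h2 := l1_rel_emb_le hj hblock
  rw [List.length_append, List.length_append, List.length_append, length_treeWord, List.length_singleton, wordRev, List.length_reverse,
    List.length_map, length_treeWord, List.length_replicate]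
  have h4 : 2 * (P.d * ((P.L - 1) / 2)) + P.d = P.d * P.L := by
    conv_rhs => rw [← hL]
    ring
  have h5 : (P.d + 2) * P.L = P.d * P.L + 2 * P.L := by ring
  omega

/-- The bound `(n²∕4)·[ε + 2θ·((n + 2)·η)]` is monotone in `n`. [folklore] -/
private theorem relBound_mono {θ ε η : ℝ} (hθ0 : 0 ≤ θ) (hε0 : 0 ≤ ε) (hη0 : 0 ≤ η) {n m : ℝ} (hn : 0 ≤ n) (hnm : n ≤ m) :
    (n ^ 2 / 4) * (ε + 2 * θ * ((n + 2) * η)) ≤ (m ^ 2 / 4) * (ε + 2 * θ * ((m + 2) * η)) := by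
  have h1 : n ^ 2 / 4 ≤ m ^ 2 / 4 := by nlinarith
  have h3 : (n + 2) * η ≤ (m + 2) * η := mul_le_mul_of_nonneg_right (by linarith) hη0
  have h2 : ε + 2 * θ * ((n + 2) * η) ≤ ε + 2 * θ * ((m + 2) * η) := by
    have := mul_le_mul_of_nonneg_left h3 (mul_nonneg zero_le_two hθ0)
    linarith
  exact mul_le_mul h1 h2 (by positivity) (by positivity)

/-! ## §2 INTERIOR bonds: every input a neighbourhood sum -/

section Interior

variable {G : Type*} [GaugeGroup G]

/-- ★★ **THE TWO-TOWER INTERIOR LETTER IN LOCAL SUM CURRENCY** (standing range; `b = ⟨x, μ⟩` with both endpoints in the block of `y`; the pairs `(W, U)` — tower 1, carrying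
every SIZE: `PlaqSmall θ_W W`, `PlaqSmall θ_U U` — and `(W⁰, U⁰)` comb-axial from every block centre):
`δ(W_b·U_b⁻¹, W⁰_b·U⁰_b⁻¹) ≤ K·(Σ_{N(y)} δ_q(W,W⁰) + 2θ_W·((K′+2)·Σ_{N_b(y)} dev(W,W⁰))) + K·(Σ_{N(y)} δ_q(U,U⁰) + 2θ_U·((K′+2)·Σ_{N_b(y)} dev(U,U⁰)))
 + 2·(Kθ_W + Kθ_U)·(K′·Σ_{N_b(y)} dev(U,U⁰))`, `K′ = (d+2)L`, `K = K′²∕4` — C1's letter with `a, b` ⟸ ✓p823652 (count box ⊆ block, C2), `θ₁, θ₂` ⟸ lit Stokes, `t` ⟸ ✓p823337 §1.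
[cite: Balaban1985RegularSpaces, Lemma 1 (1.25) p.79; Balaban1985Averaging, (19)-(20) p.21] -/
theorem dist1_flap_rel_le_interior_nbhd (hcomm : ∀ g h : G, dist1 (g * h * g⁻¹ * h⁻¹) ≤ 2 * dist1 g * dist1 h) (hj : j + 1 ≤ P.m + P.K)
    (W U W₀ U₀ : GaugeField P j G)
    (hax : ∀ z : Site P j, axialT W (emb (blockOf z)) z = axialT U (emb (blockOf z)) z)
    (hax₀ : ∀ z : Site P j, axialT W₀ (emb (blockOf z)) z = axialT U₀ (emb (blockOf z)) z)
    {θW θU : ℝ} (hθW0 : 0 ≤ θW) (hθU0 : 0 ≤ θU) (hW : PlaqSmall θW W) (hU : PlaqSmall θU U)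
    {x : Site P j} {y : Site P (j + 1)} (hx : blockOf x = y) (μ : Fin P.d) (hblock : blockOf (x.shift μ) = y) :
    dist1 ((W₀ ⟨x, μ⟩ * (U₀ ⟨x, μ⟩)⁻¹)⁻¹ * (W ⟨x, μ⟩ * (U ⟨x, μ⟩)⁻¹)) ≤
      ((((P.d + 2) * P.L : ℕ) : ℝ) ^ 2 / 4) *
          (∑ q ∈ Finset.univ.filter (fun q : Plaq P j => ∀ κ, blockOf q.src κ = y κ ∨ blockOf q.src κ = y κ + 1 ∨ blockOf q.src κ = y κ - 1),
              dist1 ((GaugeField.plaqHol W₀ q)⁻¹ * GaugeField.plaqHol W q) +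
            2 * θW * (((((P.d + 2) * P.L : ℕ) : ℝ) + 2) *
              ∑ b ∈ Finset.univ.filter (fun b : PBond P j => ∀ κ, blockOf b.src κ = y κ ∨ blockOf b.src κ = y κ + 1 ∨ blockOf b.src κ = y κ - 1),
                dist1 (bdev W W₀ b))) +
        ((((P.d + 2) * P.L : ℕ) : ℝ) ^ 2 / 4) *
          (∑ q ∈ Finset.univ.filter (fun q : Plaq P j => ∀ κ, blockOf q.src κ = y κ ∨ blockOf q.src κ = y κ + 1 ∨ blockOf q.src κ = y κ - 1),
              dist1 ((GaugeField.plaqHol U₀ q)⁻¹ * GaugeField.plaqHol U q) +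
            2 * θU * (((((P.d + 2) * P.L : ℕ) : ℝ) + 2) *
              ∑ b ∈ Finset.univ.filter (fun b : PBond P j => ∀ κ, blockOf b.src κ = y κ ∨ blockOf b.src κ = y κ + 1 ∨ blockOf b.src κ = y κ - 1),
                dist1 (bdev U U₀ b))) +
        2 * (((((P.d + 2) * P.L : ℕ) : ℝ) ^ 2 / 4) * θW + ((((P.d + 2) * P.L : ℕ) : ℝ) ^ 2 / 4) * θU) *
          ((((P.d + 2) * P.L : ℕ) : ℝ) *
            ∑ b ∈ Finset.univ.filter (fun b : PBond P j => ∀ κ, blockOf b.src κ = y κ ∨ blockOf b.src κ = y κ + 1 ∨ blockOf b.src κ = y κ - 1),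
              dist1 (bdev U U₀ b)) := by
  classical
  -- abbreviations
  set K' : ℝ := (((P.d + 2) * P.L : ℕ) : ℝ) with hK'
  set SPW := ∑ q ∈ Finset.univ.filter (fun q : Plaq P j => ∀ κ, blockOf q.src κ = y κ ∨ blockOf q.src κ = y κ + 1 ∨ blockOf q.src κ = y κ - 1),
      dist1 ((GaugeField.plaqHol W₀ q)⁻¹ * GaugeField.plaqHol W q) with hSPW
  set SPU := ∑ q ∈ Finset.univ.filter (fun q : Plaq P j => ∀ κ, blockOf q.src κ = y κ ∨ blockOf q.src κ = y κ + 1 ∨ blockOf q.src κ = y κ - 1),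
      dist1 ((GaugeField.plaqHol U₀ q)⁻¹ * GaugeField.plaqHol U q) with hSPU
  set SBW := ∑ b ∈ Finset.univ.filter (fun b : PBond P j => ∀ κ, blockOf b.src κ = y κ ∨ blockOf b.src κ = y κ + 1 ∨ blockOf b.src κ = y κ - 1),
      dist1 (bdev W W₀ b) with hSBW
  set SBU := ∑ b ∈ Finset.univ.filter (fun b : PBond P j => ∀ κ, blockOf b.src κ = y κ ∨ blockOf b.src κ = y κ + 1 ∨ blockOf b.src κ = y κ - 1),
      dist1 (bdev U U₀ b) with hSBU
  have hSPW0 : 0 ≤ SPW := Finset.sum_nonneg fun _ _ => GaugeGroup.dist1_nonneg _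
  have hSPU0 : 0 ≤ SPU := Finset.sum_nonneg fun _ _ => GaugeGroup.dist1_nonneg _
  have hSBW0 : 0 ≤ SBW := Finset.sum_nonneg fun _ _ => GaugeGroup.dist1_nonneg _
  have hSBU0 : 0 ≤ SBU := Finset.sum_nonneg fun _ _ => GaugeGroup.dist1_nonneg _
  set C := contourT (emb y) ⟨x, μ⟩ with hC
  -- locality of the count box: in the block of `y`, hence near `y`
  have hnear : ∀ u : List (Letter P.d), (∀ l, u.count l ≤ C.count l) →
      ∀ κ, blockOf (walkEnd (emb y) u) κ = y κ ∨ blockOf (walkEnd (emb y) u) κ = y κ + 1 ∨ blockOf (walkEnd (emb y) u) κ = y κ - 1 := by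
    intro u hu
    rw [blockOf_walkEnd_of_count_le_contour hj hx μ hblock u hu]
    exact near_self y
  have hεloc : ∀ (X X₀ : GaugeField P j G) (u : List (Letter P.d)), (∀ l, u.count l ≤ C.count l) → ∀ (a c : Fin P.d) (hac : a < c),
      dist1 ((GaugeField.plaqHol X₀ ⟨walkEnd (emb y) u, a, c, hac⟩)⁻¹ * GaugeField.plaqHol X ⟨walkEnd (emb y) u, a, c, hac⟩) ≤
        ∑ q ∈ Finset.univ.filter (fun q : Plaq P j => ∀ κ, blockOf q.src κ = y κ ∨ blockOf q.src κ = y κ + 1 ∨ blockOf q.src κ = y κ - 1),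
          dist1 ((GaugeField.plaqHol X₀ q)⁻¹ * GaugeField.plaqHol X q) := by
    intro X X₀ u hu a c hac
    exact Finset.single_le_sum (f := fun q : Plaq P j => dist1 ((GaugeField.plaqHol X₀ q)⁻¹ * GaugeField.plaqHol X q))
      (fun _ _ => GaugeGroup.dist1_nonneg _) (Finset.mem_filter.mpr ⟨Finset.mem_univ _, hnear u hu⟩)
  have hηloc : ∀ (X X₀ : GaugeField P j G) (u : List (Letter P.d)), (∀ l, u.count l ≤ C.count l) → ∀ ν : Fin P.d,
      dist1 (bdev X X₀ ⟨walkEnd (emb y) u, ν⟩) ≤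
        ∑ b ∈ Finset.univ.filter (fun b : PBond P j => ∀ κ, blockOf b.src κ = y κ ∨ blockOf b.src κ = y κ + 1 ∨ blockOf b.src κ = y κ - 1),
          dist1 (bdev X X₀ b) := by
    intro X X₀ u hu ν
    exact Finset.single_le_sum (f := fun b : PBond P j => dist1 (bdev X X₀ b))
      (fun _ _ => GaugeGroup.dist1_nonneg _) (Finset.mem_filter.mpr ⟨Finset.mem_univ _, hnear u hu⟩)
  have hCnull : ∀ ν, netDisp C ν = 0 := fun ν => netDisp_contourT (emb y) x μ ν
  have hClen : (C.length : ℝ) ≤ K' := by rw [hK']; exact_mod_cast length_contourT_le hj hx μ hblock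
  have hClen0 : (0 : ℝ) ≤ C.length := Nat.cast_nonneg _
  -- a: the relative contour loop of (W, W⁰)
  have ha := dist1_holAt_rel_le_local W W₀ hcomm hθW0 hSPW0 hSBW0 (emb y) C (fun u _ a c hac => hW _) (hεloc W W₀) (hηloc W W₀) hCnull
  have ha' := ha.trans (relBound_mono hθW0 hSPW0 hSBW0 hClen0 hClen)
  -- b: the relative contour loop of (U, U⁰)
  have hb := dist1_holAt_rel_le_local U U₀ hcomm hθU0 hSPU0 hSBU0 (emb y) C (fun u _ a c hac => hU _) (hεloc U U₀) (hηloc U U₀) hCnull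
  have hb' := hb.trans (relBound_mono hθU0 hSPU0 hSBU0 hClen0 hClen)
  -- θ₁, θ₂: the loop sizes
  have hθ₁ := LatticeWordStokes.dist1_holAt_le W hθW0 hW C hCnull (emb y)
  have hθ₂ := LatticeWordStokes.dist1_holAt_le U hθU0 hU C hCnull (emb y)
  have hsq : (C.length : ℝ) ^ 2 / 4 ≤ K' ^ 2 / 4 := by nlinarith
  have hθ₁' : dist1 (holAt W (walk (emb y) C)) ≤ K' ^ 2 / 4 * θW := hθ₁.trans (mul_le_mul_of_nonneg_right hsq hθW0)
  have hθ₂' : dist1 (holAt U (walk (emb y) C)) ≤ K' ^ 2 / 4 * θU := hθ₂.trans (mul_le_mul_of_nonneg_right hsq hθU0)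
  -- t: the relative comb transport of the backgrounds, read on `(U⁰, U)` along the tree word (a sublist of the contour)
  have hsub : (treeWord (rel (emb y) x)).Sublist C := by
    rw [hC, contourT_eq]; exact (List.sublist_append_left _ _).trans (List.sublist_append_left _ _)
  have ht := dist1_holAt_walk_rel_le_local U₀ U (treeWord (rel (emb y) x)) (emb y) (fun u hu ν => by
    rw [dist1_bdev_comm]
    exact hηloc U U₀ u (fun l => (hu l).trans (hsub.count_le l)) ν)
  have htlen : ((treeWord (rel (emb y) x)).length : ℝ) ≤ K' := by
    have h := hsub.length_le
    have : ((treeWord (rel (emb y) x)).length : ℝ) ≤ C.length := by exact_mod_cast h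
    linarith
  have ht' : dist1 ((holAt U (walk (emb y) (treeWord (rel (emb y) x))))⁻¹ * holAt U₀ (walk (emb y) (treeWord (rel (emb y) x)))) ≤ K' * SBU :=
    ht.trans (mul_le_mul_of_nonneg_right htlen hSBU0)
  -- assemble through C1
  have hmain := dist1_flap_rel_le_interior hcomm hj W U W₀ U₀ hax hax₀ hx μ hblock
    (a := K' ^ 2 / 4 * (SPW + 2 * θW * ((K' + 2) * SBW))) (b := K' ^ 2 / 4 * (SPU + 2 * θU * ((K' + 2) * SBU)))
    (θ₁ := K' ^ 2 / 4 * θW) (θ₂ := K' ^ 2 / 4 * θU) (t := K' * SBU)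
    (by rw [holT_eq_holAt, holT_eq_holAt]; exact ha') (by rw [holT_eq_holAt, holT_eq_holAt]; exact hb')
    (by rw [holT_eq_holAt]; exact hθ₁') (by rw [holT_eq_holAt]; exact hθ₂')
    (by unfold axialT; rw [holT_eq_holAt, holT_eq_holAt]; exact ht')
  exact hmain

end Interior

/-! ## §3 FACE bonds: every input a neighbourhood sum, the relative spine quotient verbatim -/

section Face

variable {G : Type*} [GaugeGroup G]

/-- ★★ **THE TWO-TOWER FACE LETTER IN LOCAL SUM CURRENCY** (standing range; `b = ⟨x, μ⟩` with `x` on the `μ`-face of the block of `y`; tower 1 `(W, U)` carries every SIZE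
— `PlaqSmall θ_W W`, `PlaqSmall θ_U U`, `σ ≥ dist1 (T_c(W)·T_c(U)⁻¹)` —; both pairs comb-axial from every block centre): with `S = T_c(W)·T_c(U)⁻¹`, `S⁰ = T_c(W⁰)·T_c(U⁰)⁻¹`
at `c = ⟨y, μ⟩`,
`δ(W_b·U_b⁻¹, W⁰_b·U⁰_b⁻¹) ≤ K·(Σ_{N(y)} δ_q(W,W⁰) + 2θ_W·((K′+2)·Σ_{N_b(y)} dev(W,W⁰))) + dist1 (S⁰⁻¹·S) + K·(Σ_{N(y)} δ_q(U,U⁰) + 2θ_U·((K′+2)·Σ_{N_b(y)} dev(U,U⁰)))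
 + 2·(Kθ_W + σ + Kθ_U)·(K′·Σ_{N_b(y)} dev(U,U⁰))` — C1's face letter with `a, b` ⟸ ✓p823652 (count box ⊆ three blocks, C2), `θ₁, θ₂` ⟸ lit Stokes, `t` ⟸ ✓p823337 §1.
[cite: Balaban1985RegularSpaces, Lemma 1 (1.26) p.79; Balaban1985Averaging, (19)-(20) p.21; Balaban1987RG1, (0.4) p.253] -/
theorem dist1_flap_rel_le_face_nbhd (hcomm : ∀ g h : G, dist1 (g * h * g⁻¹ * h⁻¹) ≤ 2 * dist1 g * dist1 h) (hj : j + 1 ≤ P.m + P.K)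
    (W U W₀ U₀ : GaugeField P j G)
    (hax : ∀ z : Site P j, axialT W (emb (blockOf z)) z = axialT U (emb (blockOf z)) z)
    (hax₀ : ∀ z : Site P j, axialT W₀ (emb (blockOf z)) z = axialT U₀ (emb (blockOf z)) z)
    {θW θU σ : ℝ} (hθW0 : 0 ≤ θW) (hθU0 : 0 ≤ θU) (hW : PlaqSmall θW W) (hU : PlaqSmall θU U)
    {x : Site P j} {y : Site P (j + 1)} (hx : blockOf x = y) {μ : Fin P.d} (hface : (x μ).val % P.L + 1 = P.L)
    (hσ : dist1 (AveragingRT.axialAvg W ⟨y, μ⟩ * (AveragingRT.axialAvg U ⟨y, μ⟩)⁻¹) ≤ σ) :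
    dist1 ((W₀ ⟨x, μ⟩ * (U₀ ⟨x, μ⟩)⁻¹)⁻¹ * (W ⟨x, μ⟩ * (U ⟨x, μ⟩)⁻¹)) ≤
      ((((P.d + 2) * P.L : ℕ) : ℝ) ^ 2 / 4) *
          (∑ q ∈ Finset.univ.filter (fun q : Plaq P j => ∀ κ, blockOf q.src κ = y κ ∨ blockOf q.src κ = y κ + 1 ∨ blockOf q.src κ = y κ - 1),
              dist1 ((GaugeField.plaqHol W₀ q)⁻¹ * GaugeField.plaqHol W q) +
            2 * θW * (((((P.d + 2) * P.L : ℕ) : ℝ) + 2) *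
              ∑ b ∈ Finset.univ.filter (fun b : PBond P j => ∀ κ, blockOf b.src κ = y κ ∨ blockOf b.src κ = y κ + 1 ∨ blockOf b.src κ = y κ - 1),
                dist1 (bdev W W₀ b))) +
        dist1 ((AveragingRT.axialAvg W₀ ⟨y, μ⟩ * (AveragingRT.axialAvg U₀ ⟨y, μ⟩)⁻¹)⁻¹ *
          (AveragingRT.axialAvg W ⟨y, μ⟩ * (AveragingRT.axialAvg U ⟨y, μ⟩)⁻¹)) +
        ((((P.d + 2) * P.L : ℕ) : ℝ) ^ 2 / 4) *
          (∑ q ∈ Finset.univ.filter (fun q : Plaq P j => ∀ κ, blockOf q.src κ = y κ ∨ blockOf q.src κ = y κ + 1 ∨ blockOf q.src κ = y κ - 1),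
              dist1 ((GaugeField.plaqHol U₀ q)⁻¹ * GaugeField.plaqHol U q) +
            2 * θU * (((((P.d + 2) * P.L : ℕ) : ℝ) + 2) *
              ∑ b ∈ Finset.univ.filter (fun b : PBond P j => ∀ κ, blockOf b.src κ = y κ ∨ blockOf b.src κ = y κ + 1 ∨ blockOf b.src κ = y κ - 1),
                dist1 (bdev U U₀ b))) +
        2 * (((((P.d + 2) * P.L : ℕ) : ℝ) ^ 2 / 4) * θW + σ + ((((P.d + 2) * P.L : ℕ) : ℝ) ^ 2 / 4) * θU) *
          ((((P.d + 2) * P.L : ℕ) : ℝ) *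
            ∑ b ∈ Finset.univ.filter (fun b : PBond P j => ∀ κ, blockOf b.src κ = y κ ∨ blockOf b.src κ = y κ + 1 ∨ blockOf b.src κ = y κ - 1),
              dist1 (bdev U U₀ b)) := by
  classical
  set K' : ℝ := (((P.d + 2) * P.L : ℕ) : ℝ) with hK'
  set SPW := ∑ q ∈ Finset.univ.filter (fun q : Plaq P j => ∀ κ, blockOf q.src κ = y κ ∨ blockOf q.src κ = y κ + 1 ∨ blockOf q.src κ = y κ - 1),
      dist1 ((GaugeField.plaqHol W₀ q)⁻¹ * GaugeField.plaqHol W q) with hSPW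
  set SPU := ∑ q ∈ Finset.univ.filter (fun q : Plaq P j => ∀ κ, blockOf q.src κ = y κ ∨ blockOf q.src κ = y κ + 1 ∨ blockOf q.src κ = y κ - 1),
      dist1 ((GaugeField.plaqHol U₀ q)⁻¹ * GaugeField.plaqHol U q) with hSPU
  set SBW := ∑ b ∈ Finset.univ.filter (fun b : PBond P j => ∀ κ, blockOf b.src κ = y κ ∨ blockOf b.src κ = y κ + 1 ∨ blockOf b.src κ = y κ - 1),
      dist1 (bdev W W₀ b) with hSBW
  set SBU := ∑ b ∈ Finset.univ.filter (fun b : PBond P j => ∀ κ, blockOf b.src κ = y κ ∨ blockOf b.src κ = y κ + 1 ∨ blockOf b.src κ = y κ - 1),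
      dist1 (bdev U U₀ b) with hSBU
  have hSPW0 : 0 ≤ SPW := Finset.sum_nonneg fun _ _ => GaugeGroup.dist1_nonneg _
  have hSPU0 : 0 ≤ SPU := Finset.sum_nonneg fun _ _ => GaugeGroup.dist1_nonneg _
  have hSBW0 : 0 ≤ SBW := Finset.sum_nonneg fun _ _ => GaugeGroup.dist1_nonneg _
  have hSBU0 : 0 ≤ SBU := Finset.sum_nonneg fun _ _ => GaugeGroup.dist1_nonneg _
  set F := (treeWord (rel (emb y) x) ++ [(μ, true)] ++ wordRev (treeWord (rel (emb (y.shift μ)) (x.shift μ)))) ++ List.replicate P.L (μ, false)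
    with hF
  -- locality of the count box: in the three blocks along `μ`, hence near `y`
  have hnear : ∀ u : List (Letter P.d), (∀ l, u.count l ≤ F.count l) →
      ∀ κ, blockOf (walkEnd (emb y) u) κ = y κ ∨ blockOf (walkEnd (emb y) u) κ = y κ + 1 ∨ blockOf (walkEnd (emb y) u) κ = y κ - 1 :=
    fun u hu => near_walkEnd_of_count_le_faceLoop hj hx hface u hu
  have hεloc : ∀ (X X₀ : GaugeField P j G) (u : List (Letter P.d)), (∀ l, u.count l ≤ F.count l) → ∀ (a c : Fin P.d) (hac : a < c),
      dist1 ((GaugeField.plaqHol X₀ ⟨walkEnd (emb y) u, a, c, hac⟩)⁻¹ * GaugeField.plaqHol X ⟨walkEnd (emb y) u, a, c, hac⟩) ≤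
        ∑ q ∈ Finset.univ.filter (fun q : Plaq P j => ∀ κ, blockOf q.src κ = y κ ∨ blockOf q.src κ = y κ + 1 ∨ blockOf q.src κ = y κ - 1),
          dist1 ((GaugeField.plaqHol X₀ q)⁻¹ * GaugeField.plaqHol X q) := by
    intro X X₀ u hu a c hac
    exact Finset.single_le_sum (f := fun q : Plaq P j => dist1 ((GaugeField.plaqHol X₀ q)⁻¹ * GaugeField.plaqHol X q))
      (fun _ _ => GaugeGroup.dist1_nonneg _) (Finset.mem_filter.mpr ⟨Finset.mem_univ _, hnear u hu⟩)
  have hηloc : ∀ (X X₀ : GaugeField P j G) (u : List (Letter P.d)), (∀ l, u.count l ≤ F.count l) → ∀ ν : Fin P.d,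
      dist1 (bdev X X₀ ⟨walkEnd (emb y) u, ν⟩) ≤
        ∑ b ∈ Finset.univ.filter (fun b : PBond P j => ∀ κ, blockOf b.src κ = y κ ∨ blockOf b.src κ = y κ + 1 ∨ blockOf b.src κ = y κ - 1),
          dist1 (bdev X X₀ b) := by
    intro X X₀ u hu ν
    exact Finset.single_le_sum (f := fun b : PBond P j => dist1 (bdev X X₀ b))
      (fun _ _ => GaugeGroup.dist1_nonneg _) (Finset.mem_filter.mpr ⟨Finset.mem_univ _, hnear u hu⟩)
  have hFnull := netDisp_faceLoop hj hx hface
  have hFlen : (F.length : ℝ) ≤ K' := by rw [hK']; exact_mod_cast length_faceLoop_le hj hx hface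
  have hFlen0 : (0 : ℝ) ≤ F.length := Nat.cast_nonneg _
  have ha := dist1_holAt_rel_le_local W W₀ hcomm hθW0 hSPW0 hSBW0 (emb y) F (fun u _ a c hac => hW _) (hεloc W W₀) (hηloc W W₀) hFnull
  have ha' := ha.trans (relBound_mono hθW0 hSPW0 hSBW0 hFlen0 hFlen)
  have hb := dist1_holAt_rel_le_local U U₀ hcomm hθU0 hSPU0 hSBU0 (emb y) F (fun u _ a c hac => hU _) (hεloc U U₀) (hηloc U U₀) hFnull
  have hb' := hb.trans (relBound_mono hθU0 hSPU0 hSBU0 hFlen0 hFlen)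
  have hθ₁ := LatticeWordStokes.dist1_holAt_le W hθW0 hW F hFnull (emb y)
  have hθ₂ := LatticeWordStokes.dist1_holAt_le U hθU0 hU F hFnull (emb y)
  have hsq : (F.length : ℝ) ^ 2 / 4 ≤ K' ^ 2 / 4 := by nlinarith
  have hθ₁' : dist1 (holAt W (walk (emb y) F)) ≤ K' ^ 2 / 4 * θW := hθ₁.trans (mul_le_mul_of_nonneg_right hsq hθW0)
  have hθ₂' : dist1 (holAt U (walk (emb y) F)) ≤ K' ^ 2 / 4 * θU := hθ₂.trans (mul_le_mul_of_nonneg_right hsq hθU0)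
  have hsub : (treeWord (rel (emb y) x)).Sublist F := by
    rw [hF]; exact ((List.sublist_append_left _ _).trans (List.sublist_append_left _ _)).trans (List.sublist_append_left _ _)
  have ht := dist1_holAt_walk_rel_le_local U₀ U (treeWord (rel (emb y) x)) (emb y) (fun u hu ν => by
    rw [dist1_bdev_comm]
    exact hηloc U U₀ u (fun l => (hu l).trans (hsub.count_le l)) ν)
  have htlen : ((treeWord (rel (emb y) x)).length : ℝ) ≤ K' := by
    have h := hsub.length_le
    have : ((treeWord (rel (emb y) x)).length : ℝ) ≤ F.length := by exact_mod_cast h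
    linarith
  have ht' : dist1 ((holAt U (walk (emb y) (treeWord (rel (emb y) x))))⁻¹ * holAt U₀ (walk (emb y) (treeWord (rel (emb y) x)))) ≤ K' * SBU :=
    ht.trans (mul_le_mul_of_nonneg_right htlen hSBU0)
  have hmain := dist1_flap_rel_le_face hcomm hj W U W₀ U₀ hax hax₀ hx hface
    (a := K' ^ 2 / 4 * (SPW + 2 * θW * ((K' + 2) * SBW))) (b := K' ^ 2 / 4 * (SPU + 2 * θU * ((K' + 2) * SBU)))
    (s := dist1 ((AveragingRT.axialAvg W₀ ⟨y, μ⟩ * (AveragingRT.axialAvg U₀ ⟨y, μ⟩)⁻¹)⁻¹ *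
      (AveragingRT.axialAvg W ⟨y, μ⟩ * (AveragingRT.axialAvg U ⟨y, μ⟩)⁻¹)))
    (θ₁ := K' ^ 2 / 4 * θW) (θ₂ := K' ^ 2 / 4 * θU) (σ := σ) (t := K' * SBU)
    ha' hb' le_rfl hθ₁' hθ₂' hσ (by unfold axialT; rw [holT_eq_holAt, holT_eq_holAt]; exact ht')
  exact hmain

end Face

end Summit.QuantumFields.YangMills.Theorems.FluctuationComparisonRegPrIntLS2BetaRelativeFieldLetterTwoTowerNbhd
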